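/-
Copyright: b2b-lace packet (tail-bound analyst, gen 8).  THE PAIR-NODE CLASS EXPANSION: for a `W_d`-invariant `f`
and the node `x = a e₁ + b e₂`, the `4·d(d−1)` signed injections of `SrwOrbitInjectionLaw` collapse to
`4 × 7` explicit terms with multiplicities `1, 1, (d−2) ×4, (d−2)(d−3)`; whence `W_{n,j}(a e₁ + b e₂)` and
`L_n(a e₁ + b e₂)` (`d ≥ 2n+1`) as 28 shell integrals at EXPLICIT integer vectors.  d-generic; no `sorry`.
-/
import Literature.Probability.FitznerVanDerHofstad2017.SrwOrbitInjectionLaw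
import HarnessLib

/-!
# The pair-node expansion of `W_{n,j}(a e₁ + b e₂)` into 28 shell integrals

CITATION HEADER (PLACEMENT v2). This module is part of a certified REPRODUCTION of:
R. Fitzner, R. van der Hofstad, *Mean-field behavior for nearest-neighbor percolation in d > 10*,
Electron. J. Probab. 22 (2017), no. 43 [FvdH17], and *Generalized approach to the non-backtracking lace
expansion*, Probab. Theory Related Fields 169 (2017) 1041–1119 [NoBLE17-I] (arXiv:1506.07977, 1506.07969).
Reproduces: the notebook evaluation `L[n, {a, b, 0, …}]`, `K[n, l, {a, b, 0, …}]` of `SRW.nb` §2 — the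
placement formula (5.16) p. 1092 at a node with TWO non-zero coordinates, as the explicit class sum the
notebook's `Permutations`/`Tuples` loop produces.  Origin: build `lace`, (S2b)-IMPR-L8 (GAPS I4: the `T/U`
table cells at the node `e₁ + 2e₂`, the one main node of the Q-tabulation that is not a scaled indicator
vector), tail-bound analyst gen 8 (unit b2b-lace-tail-g8); consumer of `SrwOrbitInjectionLaw`.

## The statement

Write `x = (a, b, 0, …, 0) ∈ ℤ^d` (`d ≥ 2`) and, for signs `(u, v) = (±a, ±b)`, the PLACEMENT BRACKET
`B(u, v) = f(a−u, b−v) + f(a−v, b−u) + (d−2)·[f(a−u, b, −v) + f(a, b−u, −v) + f(a−v, b, −u) + f(a, b−v, −u)]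
          + (d−2)(d−3)·f(a, b, −u, −v)`
(arguments zero-padded to length `d`; `pairBracket`).  Then for every `W_d`-INVARIANT `f`
(`sum_sgnInj_pair_eq`):
`Σ_{κ : [2] ↪ [d]} Σ_{s ∈ {±1}²} f(x − κ_*(s·x)) = B(a, b) + B(a, −b) + B(−a, b) + B(−a, −b)`,
and hence (`srwW_pair_eq`, `srwL_pair_eq`; `d ≥ 2n+1`)
`W_{n,j}(a e₁ + b e₂) = [B(a,b) + B(a,−b) + B(−a,b) + B(−a,−b)] / (d(d−1) · 4)` with `f = I_{n,2j}`.
The seven placements are `(κ0, κ1) = (0,1), (1,0), (0,μ), (1,μ), (μ,0), (μ,1), (μ,μ')` (`μ, μ' ≥ 2`);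
invariance under the transpositions `(2 μ)`, `(3 μ')` (which fix `x`) merges each family (`pairF_swap`).

## What is here (all `d`-generic)

* `intVec d l` (zero-padded integer vector), `vecOfParts_eq_intVec`; `sum_emb_fin_two` (embeddings of
  `Fin 2` = ordered pairs of distinct indices); `sum_units_int`;
* `pairF`, `pairF_perm`, `pairF_swap`, the seven evaluations `pairF_01 … pairF_23`;
* **`sum_pairF_eq`**, **`sum_sgnInj_pair_eq`**, **`srwW_pair_eq`**, **`srwL_pair_eq`**.

## What is NOT here
No dimension, no table, no numeric value.  At `d = 11`, `(a, b) = (2, 1)` the 28 vectors are explicit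
`intVec 11 [...]` terms which a certificate file reduces to tabulated classes by `srwI_spAct` +
`absMonotone_srwI` exactly as `MeanFieldD11Stage1TabsK.shUp_sound` does.

## References
* [NoBLE17-I] R. Fitzner, R. van der Hofstad, PTRF 169 (2017) 1041–1119; arXiv:1506.07969 — Def. 2.5
  p. 1058, (5.16) p. 1092; notebook `SRW.nb` §2 (arXiv:1506.07977 anc).
-/

namespace Literature.Probability.FitznerVanDerHofstad2017

open Finset

variable {d : ℕ}

/-! ### A. Zero-padded integer vectors, small index facts -/

/-- The zero-padded integer vector `(l₀, …, l_{m−1}, 0, …, 0) ∈ ℤ^d` of a list `l`. [folklore] -/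
def intVec (d : ℕ) (l : List ℤ) : Fin d → ℤ := fun μ => l.getD (μ : ℕ) 0

/-- Unfolding. [folklore] -/
theorem intVec_apply (l : List ℤ) (μ : Fin d) : intVec d l μ = l.getD (μ : ℕ) 0 := rfl

/-- Beyond the list the vector vanishes. [folklore] -/
theorem intVec_apply_of_le (l : List ℤ) (μ : Fin d) (h : l.length ≤ (μ : ℕ)) : intVec d l μ = 0 := by
  rw [intVec_apply, List.getD_eq_getElem?_getD, List.getElem?_eq_none h]
  rfl

/-- `vecOfParts` is the `intVec` of the cast list. [folklore] -/
theorem vecOfParts_eq_intVec (p : List ℕ) :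
    vecOfParts d p = intVec d (p.map fun n : ℕ => (n : ℤ)) := by
  funext μ
  simp only [vecOfParts, intVec_apply, List.getD_eq_getElem?_getD, List.getElem?_map]
  generalize p[(μ : ℕ)]? = o
  cases o <;> rfl

/-- `Σ_{s ∈ ℤˣ} g(s) = g(1) + g(−1)`. [folklore] -/
theorem sum_units_int (g : ℤˣ → ℝ) : ∑ s, g s = g 1 + g (-1) := by
  have h : (univ : Finset ℤˣ) = {1, -1} := rfl
  rw [h, Finset.sum_pair (by decide)]

/-- Distinct literals give distinct indices. [folklore] -/
theorem fin_mk_ne_mk {j k : ℕ} (hj : j < d) (hk : k < d) (h : j ≠ k) : (⟨j, hj⟩ : Fin d) ≠ ⟨k, hk⟩ :=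
  fun e => h (congrArg Fin.val e)

/-- A literal index below `μ` differs from `μ`. [folklore] -/
theorem fin_mk_ne_of_lt {k : ℕ} (hk : k < d) (μ : Fin d) (h : k < (μ : ℕ)) : (⟨k, hk⟩ : Fin d) ≠ μ :=
  fun e => by have := congrArg Fin.val e; simp only at this; omega

/-! ### B. Embeddings of `Fin 2` are ordered pairs of distinct indices -/

/-- `([2] ↪ [d]) ≃ {(μ, μ') : μ ≠ μ'}`. [folklore] -/
def embFinTwoEquiv (d : ℕ) : (Fin 2 ↪ Fin d) ≃ {q : Fin d × Fin d // q.1 ≠ q.2} where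
  toFun κ := ⟨(κ 0, κ 1), fun h => absurd (κ.injective h) (by decide)⟩
  invFun q := ⟨![q.1.1, q.1.2], fun i j hij => by
    fin_cases i <;> fin_cases j
    · rfl
    · exact absurd (by simpa using hij) q.2
    · exact absurd (by simpa using hij.symm) q.2
    · rfl⟩
  left_inv κ := by
    ext i
    fin_cases i <;> rfl
  right_inv q := Subtype.ext (Prod.ext rfl rfl)

/-- `Σ_{κ : [2] ↪ [d]} G(κ0, κ1) = Σ_μ Σ_{μ' ≠ μ} G(μ, μ')`. [folklore] -/
theorem sum_emb_fin_two (G : Fin d → Fin d → ℝ) :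
    ∑ κ : Fin 2 ↪ Fin d, G (κ 0) (κ 1) = ∑ μ, ∑ μ' ∈ univ.erase μ, G μ μ' := by
  rw [Fintype.sum_equiv (embFinTwoEquiv d) (fun κ => G (κ 0) (κ 1))
      (fun q => G q.1.1 q.1.2) (fun κ => rfl),
    ← Finset.sum_subtype (univ.filter fun q : Fin d × Fin d => q.1 ≠ q.2) (by simp)
      (fun q : Fin d × Fin d => G q.1 q.2),
    Finset.sum_filter, ← Finset.univ_product_univ, Finset.sum_product]
  refine Finset.sum_congr rfl fun μ _ => ?_
  rw [← Finset.filter_ne univ μ, Finset.sum_filter]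

/-! ### C. The pair term and its symmetries -/

/-- The PAIR TERM `F(μ, μ') = f(x − u e_μ − v e_{μ'})`. [folklore] -/
def pairF (f : (Fin d → ℤ) → ℝ) (x : Fin d → ℤ) (u v : ℤ) (μ μ' : Fin d) : ℝ :=
  f (x - Pi.single μ u - Pi.single μ' v)

/-- For `κ : [2] ↪ [d]`: `κ_*(s·c) = s₀c₀ e_{κ0} + s₁c₁ e_{κ1}`. [folklore] -/
theorem sgnInjVec_fin_two (κ : Fin 2 ↪ Fin d) (s : Fin 2 → ℤˣ) (c : Fin 2 → ℤ) :
    sgnInjVec κ s c = Pi.single (κ 0) ((s 0 : ℤ) * c 0) + Pi.single (κ 1) ((s 1 : ℤ) * c 1) := by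
  funext ν
  rw [Pi.add_apply, Pi.single_apply, Pi.single_apply]
  simp only [sgnInjVec, Fin.sum_univ_two]
  by_cases h0 : κ 0 = ν
  · by_cases h1 : κ 1 = ν
    · simp [h0, h1]
    · simp [h0, h1, Ne.symm h1]
  · by_cases h1 : κ 1 = ν
    · simp [h0, h1, Ne.symm h0]
    · simp [h0, h1, Ne.symm h0, Ne.symm h1]

/-- The summand of the signed-injection law at a pair node is a pair term. [folklore] -/
theorem sub_sgnInjVec_pair_eq (f : (Fin d → ℤ) → ℝ) (x : Fin d → ℤ) (κ : Fin 2 ↪ Fin d)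
    (s : Fin 2 → ℤˣ) (a b : ℤ) :
    f (x - sgnInjVec κ s ![a, b]) = pairF f x ((s 0 : ℤ) * a) ((s 1 : ℤ) * b) (κ 0) (κ 1) := by
  rw [pairF, sgnInjVec_fin_two, sub_add_eq_sub_sub]
  simp only [Matrix.cons_val_zero, Matrix.cons_val_one]

/-- Re-placing by a permutation fixing `x`: `F(μ, μ') = F(σ⁻¹ μ, σ⁻¹ μ')` for `W_d`-invariant `f` and
`x ∘ σ = x`. [cite: FitznerVanDerHofstad2016NoBLE, (3.35) p. 1071] -/
theorem pairF_perm (f : (Fin d → ℤ) → ℝ) (hf : ∀ (ρ : SgnPermPair d) (z : Fin d → ℤ), f (spAct ρ z) = f z)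
    (x : Fin d → ℤ) (σ : Equiv.Perm (Fin d)) (hσ : ∀ i, x (σ i) = x i) (u v : ℤ) (μ μ' : Fin d) :
    pairF f x u v μ μ' = pairF f x u v (σ.symm μ) (σ.symm μ') := by
  unfold pairF
  conv_lhs => rw [← hf (σ, 1)]
  congr 1
  funext i
  have h1 : ∀ (ν : Fin d) (w : ℤ),
      (Pi.single ν w : Fin d → ℤ) (σ i) = (Pi.single (σ.symm ν) w : Fin d → ℤ) i := by
    intro ν w
    by_cases h : σ i = ν
    · rw [h, Pi.single_eq_same, show σ.symm ν = i by rw [← h, Equiv.symm_apply_apply],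
        Pi.single_eq_same]
    · rw [Pi.single_eq_of_ne h, Pi.single_eq_of_ne]
      intro h'
      exact h (by rw [h', Equiv.apply_symm_apply])
  simp only [spAct_apply, Pi.one_apply, Units.val_one, one_mul, Pi.sub_apply, hσ, h1]

section Pair

variable (a b : ℤ)

/-- The node `(a, b, 0, …)` vanishes at indices `≥ 2`. [folklore] -/
theorem intVec_pair_apply_of_two_le (μ : Fin d) (h : 2 ≤ (μ : ℕ)) : intVec d [a, b] μ = 0 :=
  intVec_apply_of_le _ μ (by simpa using h)

/-- A transposition of two indices `≥ 2` fixes the node `(a, b, 0, …)`. [folklore] -/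
theorem intVec_pair_swap (p q : Fin d) (hp : 2 ≤ (p : ℕ)) (hq : 2 ≤ (q : ℕ)) (i : Fin d) :
    intVec d [a, b] (Equiv.swap p q i) = intVec d [a, b] i := by
  by_cases hip : i = p
  · rw [hip, Equiv.swap_apply_left, intVec_pair_apply_of_two_le a b q hq,
      intVec_pair_apply_of_two_le a b p hp]
  · by_cases hiq : i = q
    · rw [hiq, Equiv.swap_apply_right, intVec_pair_apply_of_two_le a b p hp,
        intVec_pair_apply_of_two_le a b q hq]
    · rw [Equiv.swap_apply_of_ne_of_ne hip hiq]

/-- Re-placing by a transposition beyond the support.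
[cite: FitznerVanDerHofstad2016NoBLE, (3.35) p. 1071] -/
theorem pairF_swap (f : (Fin d → ℤ) → ℝ) (hf : ∀ (ρ : SgnPermPair d) (z : Fin d → ℤ), f (spAct ρ z) = f z)
    (u v : ℤ) (p q : Fin d) (hp : 2 ≤ (p : ℕ)) (hq : 2 ≤ (q : ℕ)) (μ μ' : Fin d) :
    pairF f (intVec d [a, b]) u v μ μ' =
      pairF f (intVec d [a, b]) u v (Equiv.swap p q μ) (Equiv.swap p q μ') := by
  have h := pairF_perm f hf (intVec d [a, b]) (Equiv.swap p q) (intVec_pair_swap a b p q hp hq) u v μ μ'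
  rwa [Equiv.symm_swap] at h

/-! ### D. The seven placements, evaluated -/

/-- `F(0, 1) = f(a−u, b−v)`. [folklore] -/
theorem pairF_01 (f : (Fin d → ℤ) → ℝ) (u v : ℤ) (h0 : 0 < d) (h1 : 1 < d) :
    pairF f (intVec d [a, b]) u v ⟨0, h0⟩ ⟨1, h1⟩ = f (intVec d [a - u, b - v]) := by
  unfold pairF; congr 1; funext i
  rcases i with ⟨n, hn⟩
  simp only [Pi.sub_apply, intVec_apply, Pi.single_apply, Fin.mk.injEq]
  rcases n with _ | _ | n <;> simp

/-- `F(1, 0) = f(a−v, b−u)`. [folklore] -/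
theorem pairF_10 (f : (Fin d → ℤ) → ℝ) (u v : ℤ) (h0 : 0 < d) (h1 : 1 < d) :
    pairF f (intVec d [a, b]) u v ⟨1, h1⟩ ⟨0, h0⟩ = f (intVec d [a - v, b - u]) := by
  unfold pairF; congr 1; funext i
  rcases i with ⟨n, hn⟩
  simp only [Pi.sub_apply, intVec_apply, Pi.single_apply, Fin.mk.injEq]
  rcases n with _ | _ | n <;> simp

/-- `F(0, 2) = f(a−u, b, −v)`. [folklore] -/
theorem pairF_02 (f : (Fin d → ℤ) → ℝ) (u v : ℤ) (h0 : 0 < d) (h2 : 2 < d) :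
    pairF f (intVec d [a, b]) u v ⟨0, h0⟩ ⟨2, h2⟩ = f (intVec d [a - u, b, -v]) := by
  unfold pairF; congr 1; funext i
  rcases i with ⟨n, hn⟩
  simp only [Pi.sub_apply, intVec_apply, Pi.single_apply, Fin.mk.injEq]
  rcases n with _ | _ | _ | n <;> simp

/-- `F(1, 2) = f(a, b−u, −v)`. [folklore] -/
theorem pairF_12 (f : (Fin d → ℤ) → ℝ) (u v : ℤ) (h1 : 1 < d) (h2 : 2 < d) :
    pairF f (intVec d [a, b]) u v ⟨1, h1⟩ ⟨2, h2⟩ = f (intVec d [a, b - u, -v]) := by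
  unfold pairF; congr 1; funext i
  rcases i with ⟨n, hn⟩
  simp only [Pi.sub_apply, intVec_apply, Pi.single_apply, Fin.mk.injEq]
  rcases n with _ | _ | _ | n <;> simp

/-- `F(2, 0) = f(a−v, b, −u)`. [folklore] -/
theorem pairF_20 (f : (Fin d → ℤ) → ℝ) (u v : ℤ) (h0 : 0 < d) (h2 : 2 < d) :
    pairF f (intVec d [a, b]) u v ⟨2, h2⟩ ⟨0, h0⟩ = f (intVec d [a - v, b, -u]) := by
  unfold pairF; congr 1; funext i
  rcases i with ⟨n, hn⟩
  simp only [Pi.sub_apply, intVec_apply, Pi.single_apply, Fin.mk.injEq]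
  rcases n with _ | _ | _ | n <;> simp

/-- `F(2, 1) = f(a, b−v, −u)`. [folklore] -/
theorem pairF_21 (f : (Fin d → ℤ) → ℝ) (u v : ℤ) (h1 : 1 < d) (h2 : 2 < d) :
    pairF f (intVec d [a, b]) u v ⟨2, h2⟩ ⟨1, h1⟩ = f (intVec d [a, b - v, -u]) := by
  unfold pairF; congr 1; funext i
  rcases i with ⟨n, hn⟩
  simp only [Pi.sub_apply, intVec_apply, Pi.single_apply, Fin.mk.injEq]
  rcases n with _ | _ | _ | n <;> simp

/-- `F(2, 3) = f(a, b, −u, −v)`. [folklore] -/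
theorem pairF_23 (f : (Fin d → ℤ) → ℝ) (u v : ℤ) (h2 : 2 < d) (h3 : 3 < d) :
    pairF f (intVec d [a, b]) u v ⟨2, h2⟩ ⟨3, h3⟩ = f (intVec d [a, b, -u, -v]) := by
  unfold pairF; congr 1; funext i
  rcases i with ⟨n, hn⟩
  simp only [Pi.sub_apply, intVec_apply, Pi.single_apply, Fin.mk.injEq]
  rcases n with _ | _ | _ | _ | n <;> simp

/-! ### E. The four merged families -/

variable (f : (Fin d → ℤ) → ℝ) (hf : ∀ (ρ : SgnPermPair d) (z : Fin d → ℤ), f (spAct ρ z) = f z) (u v : ℤ)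
include hf

/-- `F(0, μ) = f(a−u, b, −v)` for `μ ≥ 2`. [cite: FitznerVanDerHofstad2016NoBLE, (3.35) p. 1071] -/
theorem pairF_0μ (h0 : 0 < d) (μ : Fin d) (hμ : 2 ≤ (μ : ℕ)) :
    pairF f (intVec d [a, b]) u v ⟨0, h0⟩ μ = f (intVec d [a - u, b, -v]) := by
  have h2 : 2 < d := lt_of_le_of_lt hμ μ.isLt
  have hA : Equiv.swap (⟨2, h2⟩ : Fin d) μ ⟨0, h0⟩ = ⟨0, h0⟩ :=
    Equiv.swap_apply_of_ne_of_ne (fin_mk_ne_mk h0 h2 (by norm_num)) (fin_mk_ne_of_lt h0 μ (by omega))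
  have hB : Equiv.swap (⟨2, h2⟩ : Fin d) μ μ = ⟨2, h2⟩ := Equiv.swap_apply_right _ _
  rw [pairF_swap a b f hf u v ⟨2, h2⟩ μ (le_refl 2) hμ ⟨0, h0⟩ μ, hA, hB, pairF_02]

/-- `F(1, μ) = f(a, b−u, −v)` for `μ ≥ 2`. [cite: FitznerVanDerHofstad2016NoBLE, (3.35) p. 1071] -/
theorem pairF_1μ (h1 : 1 < d) (μ : Fin d) (hμ : 2 ≤ (μ : ℕ)) :
    pairF f (intVec d [a, b]) u v ⟨1, h1⟩ μ = f (intVec d [a, b - u, -v]) := by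
  have h2 : 2 < d := lt_of_le_of_lt hμ μ.isLt
  have hA : Equiv.swap (⟨2, h2⟩ : Fin d) μ ⟨1, h1⟩ = ⟨1, h1⟩ :=
    Equiv.swap_apply_of_ne_of_ne (fin_mk_ne_mk h1 h2 (by norm_num)) (fin_mk_ne_of_lt h1 μ (by omega))
  have hB : Equiv.swap (⟨2, h2⟩ : Fin d) μ μ = ⟨2, h2⟩ := Equiv.swap_apply_right _ _
  rw [pairF_swap a b f hf u v ⟨2, h2⟩ μ (le_refl 2) hμ ⟨1, h1⟩ μ, hA, hB, pairF_12]

/-- `F(μ, 0) = f(a−v, b, −u)` for `μ ≥ 2`. [cite: FitznerVanDerHofstad2016NoBLE, (3.35) p. 1071] -/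
theorem pairF_μ0 (h0 : 0 < d) (μ : Fin d) (hμ : 2 ≤ (μ : ℕ)) :
    pairF f (intVec d [a, b]) u v μ ⟨0, h0⟩ = f (intVec d [a - v, b, -u]) := by
  have h2 : 2 < d := lt_of_le_of_lt hμ μ.isLt
  have hA : Equiv.swap (⟨2, h2⟩ : Fin d) μ ⟨0, h0⟩ = ⟨0, h0⟩ :=
    Equiv.swap_apply_of_ne_of_ne (fin_mk_ne_mk h0 h2 (by norm_num)) (fin_mk_ne_of_lt h0 μ (by omega))
  have hB : Equiv.swap (⟨2, h2⟩ : Fin d) μ μ = ⟨2, h2⟩ := Equiv.swap_apply_right _ _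
  rw [pairF_swap a b f hf u v ⟨2, h2⟩ μ (le_refl 2) hμ μ ⟨0, h0⟩, hA, hB, pairF_20]

/-- `F(μ, 1) = f(a, b−v, −u)` for `μ ≥ 2`. [cite: FitznerVanDerHofstad2016NoBLE, (3.35) p. 1071] -/
theorem pairF_μ1 (h1 : 1 < d) (μ : Fin d) (hμ : 2 ≤ (μ : ℕ)) :
    pairF f (intVec d [a, b]) u v μ ⟨1, h1⟩ = f (intVec d [a, b - v, -u]) := by
  have h2 : 2 < d := lt_of_le_of_lt hμ μ.isLt
  have hA : Equiv.swap (⟨2, h2⟩ : Fin d) μ ⟨1, h1⟩ = ⟨1, h1⟩ :=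
    Equiv.swap_apply_of_ne_of_ne (fin_mk_ne_mk h1 h2 (by norm_num)) (fin_mk_ne_of_lt h1 μ (by omega))
  have hB : Equiv.swap (⟨2, h2⟩ : Fin d) μ μ = ⟨2, h2⟩ := Equiv.swap_apply_right _ _
  rw [pairF_swap a b f hf u v ⟨2, h2⟩ μ (le_refl 2) hμ μ ⟨1, h1⟩, hA, hB, pairF_21]

/-- `F(μ, μ') = f(a, b, −u, −v)` for distinct `μ, μ' ≥ 2`.
[cite: FitznerVanDerHofstad2016NoBLE, (3.35) p. 1071] -/
theorem pairF_μμ' (μ μ' : Fin d) (hμ : 2 ≤ (μ : ℕ)) (hμ' : 2 ≤ (μ' : ℕ)) (hne : μ' ≠ μ) :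
    pairF f (intVec d [a, b]) u v μ μ' = f (intVec d [a, b, -u, -v]) := by
  have h2 : 2 < d := lt_of_le_of_lt hμ μ.isLt
  have hval : (μ : ℕ) ≠ (μ' : ℕ) := fun h => hne (Fin.ext h).symm
  have h3 : 3 < d := by
    have := μ.isLt
    have := μ'.isLt
    omega
  have hA : Equiv.swap (⟨2, h2⟩ : Fin d) μ μ = ⟨2, h2⟩ := Equiv.swap_apply_right _ _
  rw [pairF_swap a b f hf u v ⟨2, h2⟩ μ (le_refl 2) hμ μ μ', hA]
  generalize hμ'' : Equiv.swap (⟨2, h2⟩ : Fin d) μ μ' = μ''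
  have hμ''ne : μ'' ≠ ⟨2, h2⟩ := fun h =>
    hne ((Equiv.swap (⟨2, h2⟩ : Fin d) μ).injective (hμ''.trans (h.trans hA.symm)))
  have hμ''2 : 2 ≤ (μ'' : ℕ) := by
    rw [← hμ'']
    by_cases hμ'2 : μ' = ⟨2, h2⟩
    · rw [hμ'2, Equiv.swap_apply_left]
      exact hμ
    · rw [Equiv.swap_apply_of_ne_of_ne hμ'2 hne]
      exact hμ'
  have hB : Equiv.swap (⟨3, h3⟩ : Fin d) μ'' ⟨2, h2⟩ = ⟨2, h2⟩ :=
    Equiv.swap_apply_of_ne_of_ne (fin_mk_ne_mk h2 h3 (by norm_num)) hμ''ne.symm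
  have hC : Equiv.swap (⟨3, h3⟩ : Fin d) μ'' μ'' = ⟨3, h3⟩ := Equiv.swap_apply_right _ _
  rw [pairF_swap a b f hf u v ⟨3, h3⟩ μ'' (by norm_num) hμ''2 ⟨2, h2⟩ μ'', hB, hC, pairF_23]

/-! ### F. The placement bracket and the expansion -/

omit hf in
/-- The PLACEMENT BRACKET `B(u, v)` (seven terms, multiplicities `1, 1, (d−2)×4, (d−2)(d−3)`).
[cite: FitznerVanDerHofstad2016NoBLE, (5.16) p. 1092] -/
def pairBracket (d : ℕ) (f : (Fin d → ℤ) → ℝ) (a b u v : ℤ) : ℝ :=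
  f (intVec d [a - u, b - v]) + f (intVec d [a - v, b - u])
    + ((d - 2 : ℕ) : ℝ) * (f (intVec d [a - u, b, -v]) + f (intVec d [a, b - u, -v])
        + f (intVec d [a - v, b, -u]) + f (intVec d [a, b - v, -u]))
    + ((d - 2 : ℕ) : ℝ) * ((d - 3 : ℕ) : ℝ) * f (intVec d [a, b, -u, -v])

omit hf in
/-- Members of `[d] ∖ {0, 1}` are `≥ 2`. [folklore] -/
theorem two_le_of_mem_erase_erase {h0 : 0 < d} {h1 : 1 < d} {μ : Fin d}
    (hμ : μ ∈ (univ.erase (⟨0, h0⟩ : Fin d)).erase ⟨1, h1⟩) : 2 ≤ (μ : ℕ) := by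
  rw [mem_erase, mem_erase] at hμ
  obtain ⟨hμ1, hμ0, -⟩ := hμ
  have h0' : (μ : ℕ) ≠ 0 := fun h => hμ0 (Fin.ext h)
  have h1' : (μ : ℕ) ≠ 1 := fun h => hμ1 (Fin.ext h)
  omega

omit hf in
/-- `#([d] ∖ {0, 1}) = d − 2`. [folklore] -/
theorem card_erase_erase (h0 : 0 < d) (h1 : 1 < d) :
    ((univ.erase (⟨0, h0⟩ : Fin d)).erase ⟨1, h1⟩).card = d - 2 := by
  rw [card_erase_of_mem (mem_erase.mpr ⟨fin_mk_ne_mk h1 h0 (by norm_num), mem_univ _⟩),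
    card_erase_of_mem (mem_univ _), card_univ, Fintype.card_fin]
  omega

/-- Row `μ = 0`: `Σ_{μ' ≠ 0} F(0, μ') = f(a−u, b−v) + (d−2) f(a−u, b, −v)`.
[cite: FitznerVanDerHofstad2016NoBLE, (5.16) p. 1092] -/
theorem sum_pairF_row0 (h0 : 0 < d) (h1 : 1 < d) :
    ∑ μ' ∈ univ.erase (⟨0, h0⟩ : Fin d), pairF f (intVec d [a, b]) u v ⟨0, h0⟩ μ' =
      f (intVec d [a - u, b - v]) + ((d - 2 : ℕ) : ℝ) * f (intVec d [a - u, b, -v]) := by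
  have hi1m : (⟨1, h1⟩ : Fin d) ∈ univ.erase (⟨0, h0⟩ : Fin d) :=
    mem_erase.mpr ⟨fin_mk_ne_mk h1 h0 (by norm_num), mem_univ _⟩
  rw [← Finset.add_sum_erase _ _ hi1m, pairF_01 a b f u v h0 h1,
    Finset.sum_congr rfl fun μ' hμ' => pairF_0μ a b f hf u v h0 μ' (two_le_of_mem_erase_erase hμ'),
    Finset.sum_const, card_erase_erase h0 h1, nsmul_eq_mul]

/-- Row `μ = 1`: `Σ_{μ' ≠ 1} F(1, μ') = f(a−v, b−u) + (d−2) f(a, b−u, −v)`.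
[cite: FitznerVanDerHofstad2016NoBLE, (5.16) p. 1092] -/
theorem sum_pairF_row1 (h0 : 0 < d) (h1 : 1 < d) :
    ∑ μ' ∈ univ.erase (⟨1, h1⟩ : Fin d), pairF f (intVec d [a, b]) u v ⟨1, h1⟩ μ' =
      f (intVec d [a - v, b - u]) + ((d - 2 : ℕ) : ℝ) * f (intVec d [a, b - u, -v]) := by
  have hi0m : (⟨0, h0⟩ : Fin d) ∈ univ.erase (⟨1, h1⟩ : Fin d) :=
    mem_erase.mpr ⟨fin_mk_ne_mk h0 h1 (by norm_num), mem_univ _⟩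
  rw [← Finset.add_sum_erase _ _ hi0m, erase_right_comm, pairF_10 a b f u v h0 h1,
    Finset.sum_congr rfl fun μ' hμ' => pairF_1μ a b f hf u v h1 μ' (two_le_of_mem_erase_erase hμ'),
    Finset.sum_const, card_erase_erase h0 h1, nsmul_eq_mul]

/-- Row `μ ≥ 2`: `Σ_{μ' ≠ μ} F(μ, μ') = f(a−v, b, −u) + f(a, b−v, −u) + (d−3) f(a, b, −u, −v)`.
[cite: FitznerVanDerHofstad2016NoBLE, (5.16) p. 1092] -/
theorem sum_pairF_rowμ (h0 : 0 < d) (h1 : 1 < d) (μ : Fin d) (hμ : 2 ≤ (μ : ℕ)) :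
    ∑ μ' ∈ univ.erase μ, pairF f (intVec d [a, b]) u v μ μ' =
      f (intVec d [a - v, b, -u]) + f (intVec d [a, b - v, -u])
        + ((d - 3 : ℕ) : ℝ) * f (intVec d [a, b, -u, -v]) := by
  have h10 : (⟨1, h1⟩ : Fin d) ≠ ⟨0, h0⟩ := fin_mk_ne_mk h1 h0 (by norm_num)
  have hμ0 : (⟨0, h0⟩ : Fin d) ≠ μ := fin_mk_ne_of_lt h0 μ (by omega)
  have hμ1 : (⟨1, h1⟩ : Fin d) ≠ μ := fin_mk_ne_of_lt h1 μ (by omega)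
  have hm0 : (⟨0, h0⟩ : Fin d) ∈ univ.erase μ := mem_erase.mpr ⟨hμ0, mem_univ _⟩
  have hm1 : (⟨1, h1⟩ : Fin d) ∈ (univ.erase μ).erase ⟨0, h0⟩ :=
    mem_erase.mpr ⟨h10, mem_erase.mpr ⟨hμ1, mem_univ _⟩⟩
  have hμR : μ ∈ (univ.erase (⟨0, h0⟩ : Fin d)).erase ⟨1, h1⟩ :=
    mem_erase.mpr ⟨hμ1.symm, mem_erase.mpr ⟨hμ0.symm, mem_univ _⟩⟩
  have hset : ((univ.erase μ).erase (⟨0, h0⟩ : Fin d)).erase ⟨1, h1⟩ =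
      ((univ.erase (⟨0, h0⟩ : Fin d)).erase ⟨1, h1⟩).erase μ := by
    ext ν
    simp only [mem_erase, mem_univ, and_true]
    tauto
  have hcard : (((univ.erase (⟨0, h0⟩ : Fin d)).erase ⟨1, h1⟩).erase μ).card = d - 3 := by
    rw [card_erase_of_mem hμR, card_erase_erase h0 h1]
    omega
  rw [← Finset.add_sum_erase _ _ hm0, ← Finset.add_sum_erase _ _ hm1, hset,
    pairF_μ0 a b f hf u v h0 μ hμ, pairF_μ1 a b f hf u v h1 μ hμ,
    Finset.sum_congr rfl fun μ' hμ' => pairF_μμ' a b f hf u v μ μ' hμ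
      (two_le_of_mem_erase_erase (mem_of_mem_erase hμ')) (ne_of_mem_erase hμ'),
    Finset.sum_const, hcard, nsmul_eq_mul, add_assoc]

/-- **The merged pair sum**: `Σ_μ Σ_{μ' ≠ μ} F(μ, μ') = B(u, v)` (`d ≥ 2`).
[cite: FitznerVanDerHofstad2016NoBLE, (5.16) p. 1092] -/
theorem sum_pairF_eq (hd : 2 ≤ d) :
    ∑ μ : Fin d, ∑ μ' ∈ univ.erase μ, pairF f (intVec d [a, b]) u v μ μ' = pairBracket d f a b u v := by
  have h0 : 0 < d := by omega
  have h1 : 1 < d := by omega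
  have hi1m : (⟨1, h1⟩ : Fin d) ∈ univ.erase (⟨0, h0⟩ : Fin d) :=
    mem_erase.mpr ⟨fin_mk_ne_mk h1 h0 (by norm_num), mem_univ _⟩
  rw [← Finset.add_sum_erase _ _ (mem_univ (⟨0, h0⟩ : Fin d)), sum_pairF_row0 a b f hf u v h0 h1,
    ← Finset.add_sum_erase _ _ hi1m, sum_pairF_row1 a b f hf u v h0 h1,
    Finset.sum_congr rfl fun μ hμ => sum_pairF_rowμ a b f hf u v h0 h1 μ (two_le_of_mem_erase_erase hμ),
    Finset.sum_const, card_erase_erase h0 h1, nsmul_eq_mul, pairBracket]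
  ring

/-- **The pair-node expansion of the signed-injection sum** (`d ≥ 2`, `f` `W_d`-invariant):
`Σ_{κ : [2] ↪ [d]} Σ_{s ∈ {±1}²} f(x − κ_*(s·x)) = B(a,b) + B(a,−b) + B(−a,b) + B(−a,−b)`, `x = (a, b, 0, …)`.
[cite: FitznerVanDerHofstad2016NoBLE, (5.16) p. 1092] -/
theorem sum_sgnInj_pair_eq (hd : 2 ≤ d) :
    ∑ κ : Fin 2 ↪ Fin d, ∑ s : Fin 2 → ℤˣ, f (intVec d [a, b] - sgnInjVec κ s ![a, b]) =
      pairBracket d f a b a b + pairBracket d f a b a (-b) + pairBracket d f a b (-a) b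
        + pairBracket d f a b (-a) (-b) := by
  rw [Finset.sum_comm]
  simp_rw [sub_sgnInjVec_pair_eq]
  have hs : ∀ s : Fin 2 → ℤˣ,
      ∑ κ : Fin 2 ↪ Fin d, pairF f (intVec d [a, b]) ((s 0 : ℤ) * a) ((s 1 : ℤ) * b) (κ 0) (κ 1) =
        pairBracket d f a b ((s 0 : ℤ) * a) ((s 1 : ℤ) * b) := fun s => by
    rw [sum_emb_fin_two (pairF f (intVec d [a, b]) ((s 0 : ℤ) * a) ((s 1 : ℤ) * b)),
      sum_pairF_eq a b f hf _ _ hd]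
  simp_rw [hs]
  rw [Fintype.sum_equiv (finTwoArrowEquiv ℤˣ)
      (fun s : Fin 2 → ℤˣ => pairBracket d f a b ((s 0 : ℤ) * a) ((s 1 : ℤ) * b))
      (fun q : ℤˣ × ℤˣ => pairBracket d f a b ((q.1 : ℤ) * a) ((q.2 : ℤ) * b)) (fun s => rfl),
    Fintype.sum_prod_type, sum_units_int, sum_units_int, sum_units_int]
  simp only [Units.val_one, Units.val_neg, one_mul, neg_mul]
  ring

end Pair

/-! ### G. `W_{n,j}` and `L_n` at a pair node -/

/-- **`W_{n,j}(a e₁ + b e₂)` as 28 shell integrals** (`d ≥ 2n+1`, `d ≥ 2`):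
`W_{n,j}(a, b, 0, …) = [B(a,b) + B(a,−b) + B(−a,b) + B(−a,−b)] / (d(d−1) · 4)`, `f = I_{n,2j}`.
[cite: FitznerVanDerHofstad2016NoBLE, (5.16) p. 1092] -/
theorem srwW_pair_eq {n : ℕ} (hn : 2 * n + 1 ≤ d) (hd : 2 ≤ d) (j : ℕ) (a b : ℕ) :
    srwW d n j (vecOfParts d [a, b]) =
      (pairBracket d (srwI d n (2 * j)) a b a b + pairBracket d (srwI d n (2 * j)) a b a (-b)
        + pairBracket d (srwI d n (2 * j)) a b (-a) b
        + pairBracket d (srwI d n (2 * j)) a b (-a) (-b)) /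
        ((d.descFactorial 2 : ℝ) * 2 ^ 2) := by
  rw [srwW_vecOfParts_eq_sum_sgnInj hn j [a, b] (by simpa using hd)]
  change (∑ κ : Fin 2 ↪ Fin d, ∑ s : Fin 2 → ℤˣ,
      srwI d n (2 * j) (vecOfParts d [a, b] - sgnInjVec κ s fun i => (([a, b].get i : ℕ) : ℤ))) /
      ((d.descFactorial 2 : ℝ) * 2 ^ 2) = _
  have hx : vecOfParts d [a, b] = intVec d [(a : ℤ), (b : ℤ)] := by
    rw [vecOfParts_eq_intVec]
    rfl
  have hc : (fun i : Fin 2 => (([a, b].get i : ℕ) : ℤ)) = ![(a : ℤ), (b : ℤ)] := by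
    funext i
    fin_cases i <;> rfl
  rw [hx, hc, sum_sgnInj_pair_eq (a : ℤ) (b : ℤ) (srwI d n (2 * j))
    (fun ρ z => srwI_spAct n (2 * j) ρ z) hd]

/-- **`L_n(a e₁ + b e₂)` as 28 shell integrals** (`d ≥ 2n+1`, `d ≥ 2`).
[cite: FitznerVanDerHofstad2016NoBLE, (2.19) p. 1058, (5.16) p. 1092] -/
theorem srwL_pair_eq {n : ℕ} (hn : 2 * n + 1 ≤ d) (hd : 2 ≤ d) (a b : ℕ) :
    srwL d n (vecOfParts d [a, b]) =
      (pairBracket d (srwI d n 0) a b a b + pairBracket d (srwI d n 0) a b a (-b)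
        + pairBracket d (srwI d n 0) a b (-a) b + pairBracket d (srwI d n 0) a b (-a) (-b)) /
        ((d.descFactorial 2 : ℝ) * 2 ^ 2) := by
  rw [← srwW_zero, srwW_pair_eq hn hd 0 a b, Nat.mul_zero]

end Literature.Probability.FitznerVanDerHofstad2017
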